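import Summits.HodgeConjecture.CorCM.GaloisRightStabiliserDegenerate
import Mathlib.GroupTheory.Index
import HarnessLib

/-!
# Skew CM sets ASCEND along subgroups of index `2`: a skew-bad subgroup `H ∋ c` of index `2` poisons the group

COR-CM (cell `pub-hodgecm2`), binder seat b04 (gen 23), count-neutral claim CYCLIC-BY-MULTIPLIERS, part VI (sequel of
part I `CorCM/GaloisRightStabiliserDegenerate` and part V `CorCM/GaloisSkewProducts`).  KERNEL ONLY: theorems; no
definition, no named fact, no `sorry`.  `HC_CM` is neither used nor claimed.

SETTING.  A group `G` with a central involution `c`, a subgroup `H ≤ G` of INDEX `2` containing `c`, and a SKEW CM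
set of `H`: `T_H` with `x ∈ T_H ↔ c x ∉ T_H` for `x ∈ H`, trivial left stabiliser inside `H`
(`∀ v ∈ H ∖ 1, ∃ w ∈ H, ¬(w ∈ T_H ↔ v w ∈ T_H)`), and `T_H u = T_H` on `H` for some `u ∈ H ∖ 1`.  (Field picture:
`G = Gal(K/ℚ)`, `H = Gal(K/F)` for a real quadratic subfield `F ⊆ K⁺`: a "relative skew type" of `K/F`.)  Then `H` is
non-abelian, so some `g ∈ G ∖ H` has `g² ≠ 1` (§1 `exists_not_mem_sq_ne_one`: if every element off `H` were an
involution, conjugation by one of them would invert `H`, forcing `H` abelian, and `u` would stabilise `T_H` on the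
left), and the EXTENSION

  `T = (T_H ∩ H) ⊔ g (T_H ∩ H)`   (`y ∈ T ↔ y ∈ T_H` on `H`, `↔ g⁻¹ y ∈ T_H` off `H`)

is a CM set of `G`, right-`u`-invariant, with TRIVIAL left stabiliser (§1 `indexTwo_leftStabiliser`: `v ∈ H` must
fix `T_H`; `v = g h₀` needs `h₀ T_H = T_H`, so `v = g`, and then `g² T_H = T_H` with `1 ≠ g² ∈ H`).  Hence (§2
**`exists_simple_degenerate_of_model_skew_indexTwo`**) `K` has a SIMPLE DEGENERATE abelian variety of dimension
`[K:ℚ]/2` with an exceptional Hodge class on some power.  Iterating along chains of index-`2` steps (every subgroup of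
a `2`-group is reached this way): **a Galois CM field of `2`-power degree is bad as soon as `Gal(K/F)` is skew-bad
for SOME totally real subfield `F`** with the same complex conjugation — e.g. every group of order `32` containing
`SD₁₆`, `M₁₆` (gen 22 part VIII) or a `C_{2h} ⋊ U` of parts III/IV as a subgroup through `c`.

## References

* [Shimura1998] G. Shimura, *Abelian Varieties with Complex Multiplication and Modular Functions*, §6.2 Thm. 3,
  §8.2 Prop. 26, §18.2 Lemma (i), §32.10.
* [Gordon1999HodgeAVSurvey] B. B. Gordon, *A survey of the Hodge conjecture for abelian varieties*, Thm. 6.4, §9.3.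
-/

noncomputable section

open CategoryTheory CategoryTheory.Limits NumberField
open scoped BigOperators

namespace Summit.HodgeConjecture.CorCM.GaloisModels

open Literature.NumberTheory.ComplexMultiplication
open Literature.AlgebraicGeometry.Motives (AbelianVariety CMType)
open Literature.AlgebraicGeometry.HodgeTheory
open Literature.AlgebraicGeometry.ComplexMultiplication (IsCMTypeRealisation)
open Literature.AlgebraicGeometry.Pohlmann1968
open Literature.Barriers.HodgeConjecture (divisorClassesSpan)

/-! ## §1 Extending a skew set of an index-`2` subgroup -/

section Group

variable {G : Type*} [Group G] {H : Subgroup G} {T_H : Finset G} {c u g : G}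

/-- **A subgroup with a skew CM set is non-abelian, so some element OFF it (index `2`) is not an involution**: if
every `g ∉ H` had `g² = 1`, conjugation by such a `g` would invert `H`, making `H` commutative, and then `T_H u = T_H`
would give `u T_H = T_H`, against the trivial left stabiliser. [folklore] -/
theorem exists_not_mem_sq_ne_one (hidx : H.index = 2)
    (hprim : ∀ v ∈ H, v ≠ 1 → ∃ w ∈ H, ¬ (w ∈ T_H ↔ v * w ∈ T_H)) (huH : u ∈ H) (hu : u ≠ 1)
    (hTu : ∀ x ∈ H, (x * u ∈ T_H ↔ x ∈ T_H)) : ∃ g : G, g ∉ H ∧ g * g ≠ 1 := by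
  by_contra hall
  push Not at hall
  -- some `g₀ ∉ H`
  have hne : ∃ g₀ : G, g₀ ∉ H := by
    by_contra h'
    push Not at h'
    have : H = ⊤ := eq_top_iff.2 fun x _ => h' x
    rw [this, Subgroup.index_top] at hidx
    exact absurd hidx (by norm_num)
  obtain ⟨g₀, hg₀⟩ := hne
  have hg₀2 : g₀ * g₀ = 1 := hall g₀ hg₀
  -- conjugation by `g₀` inverts `H`
  have hinv : ∀ h ∈ H, g₀ * h * g₀ = h⁻¹ := fun h hh => by
    have hgh : g₀ * h ∉ H := fun hm => hg₀ (((Subgroup.mul_mem_iff_of_index_two hidx).1 hm).2 hh)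
    have h2 := hall _ hgh
    calc g₀ * h * g₀ = (g₀ * h * (g₀ * h)) * h⁻¹ := by group
      _ = h⁻¹ := by rw [h2, one_mul]
  -- hence `H` is commutative
  have hcomm : ∀ a ∈ H, ∀ b ∈ H, a * b = b * a := fun a ha b hb => by
    have hab := hinv (a * b) (H.mul_mem ha hb)
    have e1 : (g₀ * a * g₀) * (g₀ * b * g₀) = g₀ * (a * b) * g₀ := by
      rw [show (g₀ * a * g₀) * (g₀ * b * g₀) = g₀ * a * (g₀ * g₀) * b * g₀ by group, hg₀2]; group
    rw [← e1, hinv a ha, hinv b hb, mul_inv_rev] at hab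
    have := congrArg Inv.inv hab
    simp only [mul_inv_rev, inv_inv] at this
    exact this.symm
  -- contradiction with the skew data: `u` commutes with `H`, so it stabilises `T_H` on the left
  obtain ⟨w, hwH, hw⟩ := hprim u huH hu
  exact hw (by rw [hcomm u huH w hwH]; exact (hTu w hwH).symm)

/-- **The extended set exists**: `y ∈ T ↔ y ∈ T_H` for `y ∈ H`, `y ∈ T ↔ g⁻¹ y ∈ T_H` for `y ∉ H`. [folklore] -/
theorem exists_indexTwoExtension [Fintype G] (H : Subgroup G) (T_H : Finset G) (g : G) :
    ∃ T : Finset G, (∀ y ∈ H, (y ∈ T ↔ y ∈ T_H)) ∧ (∀ y ∉ H, (y ∈ T ↔ g⁻¹ * y ∈ T_H)) := by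
  classical
  refine ⟨Finset.univ.filter fun y => (y ∈ H ∧ y ∈ T_H) ∨ (y ∉ H ∧ g⁻¹ * y ∈ T_H), fun y hy => ?_,
    fun y hy => ?_⟩
  · simp [hy]
  · simp [hy]

variable {T : Finset G}

/-- `g⁻¹ y ∈ H` for `g, y ∉ H` (index `2`). [folklore] -/
theorem inv_mul_mem_of_not_mem (hidx : H.index = 2) (hg : g ∉ H) {y : G} (hy : y ∉ H) : g⁻¹ * y ∈ H :=
  (Subgroup.mul_mem_iff_of_index_two hidx).2 ⟨fun h => absurd (by simpa using h) hg, fun h => absurd h hy⟩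

/-- **CM set for `c`** (`c ∈ H` central, `T_H` a CM set of `H`). [cite: Shimura1998, §18.2 Lemma (i)] -/
theorem indexTwo_cm (hidx : H.index = 2) (hg : g ∉ H) (hcH : c ∈ H) (hcomm : ∀ y : G, c * y = y * c)
    (hcm : ∀ x ∈ H, (x ∈ T_H ↔ c * x ∉ T_H)) (hTin : ∀ y ∈ H, (y ∈ T ↔ y ∈ T_H))
    (hTout : ∀ y ∉ H, (y ∈ T ↔ g⁻¹ * y ∈ T_H)) (y : G) : y ∈ T ↔ c * y ∉ T := by
  by_cases hy : y ∈ H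
  · rw [hTin y hy, hTin _ (H.mul_mem hcH hy)]
    exact hcm y hy
  · have hcy : c * y ∉ H := fun h => hy (by simpa using H.mul_mem (H.inv_mem hcH) h)
    rw [hTout y hy, hTout _ hcy, ← mul_assoc, ← hcomm g⁻¹, mul_assoc]
    exact hcm _ (inv_mul_mem_of_not_mem hidx hg hy)

/-- **Right invariance under `u ∈ H`.** [folklore] -/
theorem indexTwo_mul_right (hidx : H.index = 2) (hg : g ∉ H) (huH : u ∈ H)
    (hTu : ∀ x ∈ H, (x * u ∈ T_H ↔ x ∈ T_H)) (hTin : ∀ y ∈ H, (y ∈ T ↔ y ∈ T_H))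
    (hTout : ∀ y ∉ H, (y ∈ T ↔ g⁻¹ * y ∈ T_H)) (y : G) : y * u ∈ T ↔ y ∈ T := by
  by_cases hy : y ∈ H
  · rw [hTin y hy, hTin _ (H.mul_mem hy huH), hTu y hy]
  · have hyu : y * u ∉ H := fun h => hy (((Subgroup.mul_mem_iff_of_index_two hidx).1 h).2 huH)
    rw [hTout y hy, hTout _ hyu, ← mul_assoc, hTu _ (inv_mul_mem_of_not_mem hidx hg hy)]

/-- **TRIVIAL LEFT STABILISER of the extension** (`g ∉ H`, `g² ≠ 1`): `v ∈ H ∖ 1` is refuted inside `H`; `v = g h₀`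
with `h₀ ≠ 1` by the probe `w ∈ H` (`v w = g (h₀ w)` off `H`); `v = g` by the probe `g w` (`g (g w) = g² w ∈ H`,
`1 ≠ g² ∈ H`). [cite: Shimura1998, §8.2 Prop. 26] -/
theorem indexTwo_leftStabiliser (hidx : H.index = 2) (hg : g ∉ H) (hg2 : g * g ≠ 1)
    (hprim : ∀ v ∈ H, v ≠ 1 → ∃ w ∈ H, ¬ (w ∈ T_H ↔ v * w ∈ T_H))
    (hTin : ∀ y ∈ H, (y ∈ T ↔ y ∈ T_H)) (hTout : ∀ y ∉ H, (y ∈ T ↔ g⁻¹ * y ∈ T_H)) (v : G) (hv : v ≠ 1) :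
    ∃ w : G, ¬ (w ∈ T ↔ v * w ∈ T) := by
  by_cases hvH : v ∈ H
  · obtain ⟨w, hwH, hw⟩ := hprim v hvH hv
    refine ⟨w, fun hiff => hw ?_⟩
    rwa [hTin w hwH, hTin _ (H.mul_mem hvH hwH)] at hiff
  · -- `v = g h₀` with `h₀ = g⁻¹ v ∈ H`
    have h₀H : g⁻¹ * v ∈ H := inv_mul_mem_of_not_mem hidx hg hvH
    by_cases h₀ : g⁻¹ * v = 1
    · -- `v = g`: probe `g w` for the witness of `g² ≠ 1`
      have hvg : v = g := by
        rw [← mul_left_cancel_iff (a := g⁻¹), h₀, inv_mul_cancel]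
      subst hvg
      have hggH : v * v ∈ H := Subgroup.mul_self_mem_of_index_two hidx v
      obtain ⟨w, hwH, hw⟩ := hprim (v * v) hggH hg2
      refine ⟨v * w, fun hiff => hw ?_⟩
      have hvw : v * w ∉ H := fun h => hvH (((Subgroup.mul_mem_iff_of_index_two hidx).1 h).2 hwH)
      rwa [hTout _ hvw, inv_mul_cancel_left, ← mul_assoc, hTin _ (H.mul_mem hggH hwH)] at hiff
    · obtain ⟨w, hwH, hw⟩ := hprim _ h₀H h₀
      refine ⟨w, fun hiff => hw ?_⟩
      have hvw : v * w ∉ H := fun h => hvH (((Subgroup.mul_mem_iff_of_index_two hidx).1 h).2 hwH)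
      rwa [hTin w hwH, hTout _ hvw, ← mul_assoc] at hiff

end Group

/-! ## §2 Field level -/

section Field

variable {K : Type} [Field K] [NumberField K] [IsCMField K] [IsGalois ℚ K]
variable {G₀ : Type*} [Group G₀] [Fintype G₀]

/-- **THEOREM (skew sets ascend along index-`2` subgroups).**  `K` Galois CM, `e : Gal(K/ℚ) ≃* G₀`, `c₀ = e(c)`;
`H ≤ G₀` of index `2` with `c₀ ∈ H` (`H = Gal(K/F)`, `F` a real quadratic subfield), and a skew CM set of `H`:
`T_H` with `x ∈ T_H ↔ c₀ x ∉ T_H` on `H`, trivial left stabiliser in `H`, `T_H u = T_H` on `H` for some `u ∈ H ∖ 1`.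
Then `K` has a SIMPLE DEGENERATE abelian variety of dimension `|G₀|/2 = [K:ℚ]/2` with CM by `K`, with an exceptional
Hodge class on some power. [cite: Shimura1998, §6.2 Thm. 3, §8.2 Prop. 26 and §32.10]
[cite: Gordon1999HodgeAVSurvey, Thm. 6.4] -/
theorem exists_simple_degenerate_of_model_skew_indexTwo (e : (K ≃ₐ[ℚ] K) ≃* G₀) (c₀ : G₀)
    (hc : e ((IsCMField.complexConj K).restrictScalars ℚ) = c₀) (H : Subgroup G₀) (hidx : H.index = 2)
    (hcH : c₀ ∈ H) (T_H : Finset G₀) (hcm : ∀ x ∈ H, (x ∈ T_H ↔ c₀ * x ∉ T_H))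
    (hprim : ∀ v ∈ H, v ≠ 1 → ∃ w ∈ H, ¬ (w ∈ T_H ↔ v * w ∈ T_H)) {u : G₀} (huH : u ∈ H) (hu : u ≠ 1)
    (hTu : ∀ x ∈ H, (x * u ∈ T_H ↔ x ∈ T_H)) :
    ∃ (Φ : CMType K) (φ₀ : K →+* ℂ) (A : AbelianVariety ℂ) (ι : 𝓞 K →+* End A)
      (θ : K →+* Module.End ℂ (complexBetti A.X 1)),
      IsPrimitive (ℂ ≃+* ℂ) Φ.1 φ₀ ∧ ¬ IsNondegenerate Φ ∧ IsCMTypeRealisation Φ A ι θ ∧ A.IsSimple ∧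
      A.dim = Fintype.card G₀ / 2 ∧
      ∃ n p : ℕ, ∃ x : complexBetti (⨁ fun _ : Fin n => A).X (2 * p), IsRationalClass x ∧
        IsOfHodgeType (⨁ fun _ : Fin n => A).dim (⨁ fun _ : Fin n => A).X (2 * p) p p x ∧
        x ∉ divisorClassesSpan (⨁ fun _ : Fin n => A).X (⨁ fun _ : Fin n => A).dim p := by
  obtain ⟨g, hg, hg2⟩ := exists_not_mem_sq_ne_one hidx hprim huH hu hTu
  obtain ⟨T, hTin, hTout⟩ := exists_indexTwoExtension H T_H g
  have hcomm := GaloisRank.model_complexConj_comm e hc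
  exact exists_simple_degenerate_of_model_skew e c₀ hc T (indexTwo_cm hidx hg hcH hcomm hcm hTin hTout)
    (indexTwo_leftStabiliser hidx hg hg2 hprim hTin hTout) hu (indexTwo_mul_right hidx hg huH hTu hTin hTout)

end Field

end Summit.HodgeConjecture.CorCM.GaloisModels

end
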